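import Literature.AlgebraicGeometry.Smoothening.DefectZeroSmoothLocal
import Literature.AlgebraicGeometry.Resolution.RegularLocusPerfectField
import Mathlib.RingTheory.LocalRing.Module
import Mathlib.RingTheory.Valuation.ValuationSubring
import Mathlib.FieldTheory.IntermediateField.Adjoin.Defs
import HarnessLib

/-!
# The valuative Jacobian criterion
# (crux `IndSmooth.SmoothToUniformizing`, line `birth`, stub `stub_valuativeJacobian`)

Stub `stub_valuativeJacobian` of the skeleton `Lines/birth.lean` (lead reshape v2) for crux
stmt-ResolutionOfSingularities-16088. Setting: `k` a perfect field, `K/k` a field, `O` a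
valuation subring of `K`, `B ⊆ O` a finitely generated `k`-subalgebra of `K` (the structure map
`B → O` being the inclusion: any `[Algebra B O] [IsScalarTower B O K]`), `𝔭 = 𝔪_O ∩ B` the centre
of `O` on `B`. **If `O ⊗_B Ω[B⁄k]` is flat over `O`, then `B_𝔭` is a regular local ring.**

Proof (Bosch–Lütkebohmert–Raynaud, *Néron Models*, Lemma 3.3/1 ⟹, with the discrete valuation
ring replaced by the valuation ring `O`; then EGA IV 17.5.8 (iii) over a field):

1. `O` is local and `O ⊗_B Ω[B⁄k]` is finitely generated and flat, hence FREE (Stacks 00NZ,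
   Mathlib `Module.free_of_flat_of_isLocalRing`).
2. Present `B ≅ A = k[T₁, …, Tₙ]/I`; the pull-back of the differentials to `O` is unchanged
   (`tensorKaehlerEquivOfIsLocalization` along the isomorphism).
3. `A → O` is injective, so the generic point of the section is `(0)`, at which `A` is smooth
   over `k`: `A_{(0)}` is a field, a regular local ring, and over a PERFECT field regular =
   smooth (`isSmoothAt_iff_isRegularLocalRing_of_perfectField`; this is where perfectness is
   used — `Frac B = K` is separable over `k`).
4. BLR 3.3/1 ⟹ for points with values in a local domain
   (`isSmoothAt_of_free_baseChange_kaehler`, `DefectZeroSmoothLocal.lean`): `A` is smooth over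
   `k` at the closed point `𝔪_O ∩ A`.
5. Transport back to `B` (`isSmoothAt_comap_algEquiv_iff`) and conclude by "smooth over a field
   at a prime ⇒ regular local ring" (`isRegularLocalRing_of_isSmoothAt`, EGA IV 17.5.8 (iii)).

The hypotheses `(⊤ : IntermediateField k K).FG` and `IsFractionRing B K` of the registered
signature are not needed for this direction.
-/

noncomputable section

-- single-problem summit: the doubled namespace component `ResolutionOfSingularities` is forced
set_option linter.dupNamespace false

open scoped TensorProduct
open IsLocalRing Literature.AlgebraicGeometry.Smoothening Literature.AlgebraicGeometry.Resolution

namespace Summit.ResolutionOfSingularities.ResolutionOfSingularities.Theorems.IndSmoothBirth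

/-- The local ring of a Noetherian ring at a prime which is `(0)` is a regular local ring (it is
a field: its maximal ideal `(0)` is generated by `0 ≤ dim` elements). [folklore] -/
theorem isRegularLocalRing_localization_of_eq_bot {A : Type*} [CommRing A] [IsNoetherianRing A]
    (Q : Ideal A) [Q.IsPrime] (hQ : Q = ⊥) : IsRegularLocalRing (Localization.AtPrime Q) := by
  refine IsRegularLocalRing.of_spanFinrank_maximalIdeal_le _ ?_
  have hmap : Ideal.map (algebraMap A (Localization.AtPrime Q)) Q = ⊥ :=
    (Ideal.map_eq_bot_iff_le_ker _).mpr (hQ.trans_le bot_le)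
  rw [← Localization.AtPrime.map_eq_maximalIdeal, hmap, Submodule.spanFinrank_bot, Nat.cast_zero]
  exact ringKrullDim_nonneg_of_nontrivial

/-- **Stub `stub_valuativeJacobian` (line `birth`): the valuative Jacobian criterion.** For a
perfect field `k`, a valuation subring `O` of a field `K ⊇ k`, and a finitely generated
`k`-subalgebra `B ⊆ O` of `K` (structure map `B → O` the inclusion), if `O ⊗_B Ω[B⁄k]` is flat
over `O` then `B` is regular at the centre `𝔭 = 𝔪_O ∩ B` of `O`. BLR Lemma 3.3/1 ⟹ with the
discrete valuation ring replaced by the valuation ring `O` (flat = free over the local ring `O`;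
generic smoothness from perfectness of `k`), followed by EGA IV 17.5.8 (iii) over a field.
[cite: Artin1986NeronModels, (3.8) (p. 226)] -/
theorem stub_valuativeJacobian (k K : Type) [Field k] [PerfectField k] [Field K] [Algebra k K]
    (hK : (⊤ : IntermediateField k K).FG) (O : ValuationSubring K) (B : Subalgebra k K)
    (h : B.toSubring ≤ O.toSubring) (hB : B.FG) (hfr : IsFractionRing B K)
    [Algebra B O] [IsScalarTower B O K]
    (hflat : Module.Flat O (TensorProduct B O (KaehlerDifferential k B))) :
    IsRegularLocalRing (Localization.AtPrime
      (Ideal.comap (Subring.inclusion h) (IsLocalRing.maximalIdeal O))) := by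
  classical
  have _ := hK
  have _ := hfr
  -- (1) the structure map `B → O` is the inclusion; the centre `𝔭` as an ideal of `↥B`
  have hmap : ∀ b : B, algebraMap B O b = Subring.inclusion h b := fun b => by
    apply Subtype.ext
    have h1 : algebraMap B K b = algebraMap O K (algebraMap B O b) :=
      IsScalarTower.algebraMap_apply _ _ _ b
    exact h1.symm
  have hinjBO : Function.Injective (algebraMap B O) := by
    intro b₁ b₂ hb
    have hb' := congrArg (algebraMap O K) hb
    rw [← IsScalarTower.algebraMap_apply, ← IsScalarTower.algebraMap_apply] at hb'
    exact Subtype.ext hb'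
  let 𝔭 : Ideal B := Ideal.comap (Subring.inclusion h) (IsLocalRing.maximalIdeal O)
  haveI h𝔭p : 𝔭.IsPrime := Ideal.comap_isPrime _ _
  have h𝔭 : (maximalIdeal O).comap (algebraMap B O) = 𝔭 := by
    ext b
    change algebraMap B O b ∈ maximalIdeal O ↔ Subring.inclusion h b ∈ maximalIdeal O
    rw [hmap]
  -- (2) `B` is of finite type over `k`; a presentation `A = k[T₁, …, Tₙ]/I ≃ B`
  haveI hft : Algebra.FiniteType k B := B.fg_iff_finiteType.mp hB
  haveI : Algebra.FinitePresentation k B := (Algebra.FinitePresentation.of_finiteType).mp hft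
  obtain ⟨n, I, ⟨e⟩⟩ : ∃ (n : ℕ) (I : Ideal (MvPolynomial (Fin n) k)),
      Nonempty ((MvPolynomial (Fin n) k ⧸ I) ≃ₐ[k] B) := by
    obtain ⟨n, f₀, hf₀⟩ := Algebra.FiniteType.iff_quotient_mvPolynomial''.mp hft
    exact ⟨n, RingHom.ker f₀, ⟨Ideal.quotientKerAlgEquivOfSurjective hf₀⟩⟩
  -- (3) algebra structures `A → B → O` along the presentation
  letI algAB : Algebra (MvPolynomial (Fin n) k ⧸ I) B := e.toRingEquiv.toRingHom.toAlgebra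
  have hAB : ∀ x, algebraMap (MvPolynomial (Fin n) k ⧸ I) B x = e x := fun x => rfl
  haveI : IsScalarTower k (MvPolynomial (Fin n) k ⧸ I) B :=
    IsScalarTower.of_algebraMap_eq (R := k) (S := MvPolynomial (Fin n) k ⧸ I) (A := B)
      fun c => by rw [hAB, AlgEquiv.commutes]
  letI algAO : Algebra (MvPolynomial (Fin n) k ⧸ I) O :=
    ((algebraMap B O).comp (algebraMap (MvPolynomial (Fin n) k ⧸ I) B)).toAlgebra
  haveI : IsScalarTower (MvPolynomial (Fin n) k ⧸ I) B O :=
    IsScalarTower.of_algebraMap_eq (R := MvPolynomial (Fin n) k ⧸ I) (S := B) (A := O)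
      fun x => rfl
  have hbij : Function.Bijective (algebraMap (MvPolynomial (Fin n) k ⧸ I) B) := e.bijective
  haveI : IsLocalization (IsUnit.submonoid (MvPolynomial (Fin n) k ⧸ I)) B :=
    IsLocalization.of_le_isUnit_of_bijective Algebra.algebraMapSubmonoid_isUnit_le hbij
  -- (4) FLAT ⇒ FREE over the local ring `O` (Stacks 00NZ), transported along `A ≃ B`
  haveI : Module.Finite B Ω[B⁄k] := inferInstance
  haveI : Module.Free O (O ⊗[B] Ω[B⁄k]) := Module.free_of_flat_of_isLocalRing
  have hfree : Module.Free O
      (O ⊗[MvPolynomial (Fin n) k ⧸ I] Ω[(MvPolynomial (Fin n) k ⧸ I)⁄k]) :=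
    Module.Free.of_equiv (tensorKaehlerEquivOfIsLocalization k (MvPolynomial (Fin n) k ⧸ I) B
      (IsUnit.submonoid (MvPolynomial (Fin n) k ⧸ I)) O).symm
  -- (5) generic smoothness: `A → O` is injective and `A_{(0)}` is a field, regular, hence
  -- smooth over the PERFECT field `k`
  have hinjAO : Function.Injective (algebraMap (MvPolynomial (Fin n) k ⧸ I) O) :=
    hinjBO.comp hbij.1
  have hQbot : (⊥ : Ideal O).comap (algebraMap (MvPolynomial (Fin n) k ⧸ I) O) = ⊥ :=
    Ideal.comap_bot_of_injective _ hinjAO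
  have hQ : Algebra.IsSmoothAt k
      ((⊥ : Ideal O).comap (algebraMap (MvPolynomial (Fin n) k ⧸ I) O)) :=
    (isSmoothAt_iff_isRegularLocalRing_of_perfectField k (MvPolynomial (Fin n) k ⧸ I) _).mpr
      (isRegularLocalRing_localization_of_eq_bot _ hQbot)
  -- (6) BLR Lemma 3.3/1 ⟹ over the local domain `O`
  have hsmA : Algebra.IsSmoothAt k
      ((maximalIdeal O).comap (algebraMap (MvPolynomial (Fin n) k ⧸ I) O)) :=
    isSmoothAt_of_free_baseChange_kaehler I O hQ hfree
  -- (7) transport to `B` along `e`; smooth over a field at `𝔭` ⇒ `B_𝔭` regular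
  have key : ∀ (P : Ideal (MvPolynomial (Fin n) k ⧸ I)) [P.IsPrime],
      P = (maximalIdeal O).comap (algebraMap (MvPolynomial (Fin n) k ⧸ I) O) →
        Algebra.IsSmoothAt k P := by
    rintro P _ rfl
    exact hsmA
  have hsmB : Algebra.IsSmoothAt k 𝔭 := by
    refine (isSmoothAt_comap_algEquiv_iff k e 𝔭).mp (key _ ?_)
    rw [← h𝔭, Ideal.comap_comap]
    rfl
  haveI := hsmB
  exact isRegularLocalRing_of_isSmoothAt k B 𝔭

end Summit.ResolutionOfSingularities.ResolutionOfSingularities.Theorems.IndSmoothBirth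

end
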